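import Summits.CriticalPhenomena.PercolationContinuityZ3.Theorems.PercNearOneGluingNoHeavyPcintLoopExclusionSiteFirstRung
import Summits.CriticalPhenomena.PercolationContinuityZ3.Theorems.PercNearOneGluingNoHeavyPcintNawMemoryThree
import HarnessLib

/-!
# CriticalPhenomena/PercolationContinuityZ3 — Theorems/PercNearOneGluingNoHeavyPcintNawMemoryFourExact.lean: `μ^N_4(ℤ^d) = (d−1) + √((d−1)²+1)` EXACTLY (the site column's τ = 4 entry IDENTIFIED), and the first COMPLETE window instance `0 < R^N_4(ℤ³) < 1` of the typed site law

Lane prim-pcint, STRUCTURE rule; completes …PcintLoopExclusionSiteFirstRung (`μ^N_4 ≤ λ_d`, `R^N_4 > 0`) with the matching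
LOWER bound.  The memory-3 (= memory-4, shifted parity) neighbour-avoiding words are exactly the tree's `IsNAWFour` words
(no reversal, no U-turn `(a, b, −a)`): `isNawMem_three_iff_isNAWFour` of …PcintNawMemoryThree.  Their two end classes `S` (last two steps equal) / `T` (different) satisfy the Fisher–Sykes-type
recursion EXACTLY; the tree had the upper inequalities (`card_nawFourS_succ_le`, `card_nawFourT_succ_le`), this file adds the
lower ones by explicit injective continuations (`card_nawFourWords_le_card_nawFourS_succ`: `S_{n+1} ≥ S_n + T_n`;
`le_card_nawFourT_succ`: `T_{n+1} ≥ (2d−2) S_n + (2d−3) T_n`), whence with the Perron vector `(1, λ_d − 1)`,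
`λ_d² = (2d−2)λ_d + 1`: `S_n ≥ c λ_d^n`, `T_n ≥ c λ_d^n (λ_d − 1)` (`nawFourST_ge`), `N_{n+2,3} ≥ c λ_d^{n+1}` (`nawMemCount_three_ge`)
and, by `μ^N_3 = lim N_{n,3}^{1/n}` (`tendsto_nawMemCount_rpow`), **`nawFourConst_le_nawMemGrowth_three` : `λ_d ≤ μ^N_3(d)`**.

MAIN RESULTS (`d ≥ 2`):
* **`nawMemGrowth_four_eq` : `nawMemGrowth d 4 = (d−1) + √((d−1)²+1)`** (and `nawMemGrowth_three_eq`): the `τ = 4` entry of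
  the lane's site column (STRUCTURE §1; engines: 4.2360680 for `d = 3` = `2 + √5`, 6.1622777 for `d = 4` = `3 + √10`,
  8.1231056 for `d = 5` = `4 + √17`, 10.0990195 for `d = 6` = `5 + √26`) is IDENTIFIED in Lean;
* `siteLoopCost_four_eq` : `Δ^N_4(d) = ln((2d−1)/λ_d)` in closed form (with `closingNawCount_four_ge` of …PcintNawMemoryThree:
  `2·4·p^N_4(ℤ^d) ≥ 2d(2d−2)`, the opened unit squares);
* **`siteLoopCompat_four_lt_one` : `R^N_4(d) < 1` for EVERY `d ≥ 2`** — with `siteLoopCompat_four_pos` the FIRST RUNG of the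
  window clause `siteLoopCompatWindow` is COMPLETELY a theorem, `0 < R^N_4(d) < 1` (measured 0.720 / 0.797 / 0.841 / 0.869,
  d = 3..6): `Δ ≤ (2d−1)/λ_d − 1 ≤ (2d−2)/(4d²−6d+3)` (`nawFourConst_ge`: `λ_d ≥ (4d²−6d+3)/(2d−1)`), `f ≥ 8d²(d−1)/(2d−1)⁴`, and the
  polynomial inequality `(2d−2)(2d−1)⁴ < 8d²(d−1)(4d²−6d+3)` ⟺ `8d³ − 12d² + 8d − 1 > 0`; `siteLoopCompat_four_three_lt_one` (d = 3).

HONEST FRAMING: elementary transfer-matrix combinatorics; nothing here is used by a certified `p_c` cell.  Written by prim-pcint-2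
gen 16 (prover-prim-pcint-2-g16-0), 2026-08-24.
-/

noncomputable section

open Filter Topology
open Literature.Probability.LatticeModels Literature.Probability.Percolation
open Literature.Probability.FitznerVanDerHofstad2017 (wordSnoc wordSnoc_apply_of_lt wordSnoc_last wordInit_wordSnoc)
open Summit.CriticalPhenomena.PercolationContinuityZ3.Theorems.Pcint

namespace Summit.CriticalPhenomena.PercolationContinuityZ3.Theorems.Pcint.NawTail

variable {d : ℕ}

/-- Appending an admissible step keeps memory-4 neighbour-avoidance: `c ≠ −b`, `c ≠ −a` for the last two steps `a, b`. [folklore] -/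
theorem isNAWFour_wordSnoc {n : ℕ} {u : Fin (n + 2) → Fin d × Bool} (hu : IsNAWFour u) {c : Fin d × Bool}
    (hcb : c ≠ srev (u ⟨n + 1, by omega⟩)) (hca : c ≠ srev (u ⟨n, by omega⟩)) : IsNAWFour (wordSnoc u c) := by
  refine ⟨fun k hk => ?_, fun k hk => ?_⟩
  · by_cases hk2 : k + 1 < n + 2
    · rw [wordSnoc_apply_of_lt u c (show (⟨k + 1, hk⟩ : Fin (n + 2 + 1)).1 < n + 2 from hk2),
        wordSnoc_apply_of_lt u c (show (⟨k, by omega⟩ : Fin (n + 2 + 1)).1 < n + 2 by simp; omega)]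
      exact hu.1 k hk2
    · have hk' : k = n + 1 := by omega
      subst hk'
      rw [wordSnoc_apply_of_lt u c (show (⟨n + 1, by omega⟩ : Fin (n + 2 + 1)).1 < n + 2 by simp)]
      rwa [show (⟨n + 1 + 1, hk⟩ : Fin (n + 2 + 1)) = ⟨n + 2, by omega⟩ from rfl, wordSnoc_last]
  · by_cases hk2 : k + 2 < n + 2
    · rw [wordSnoc_apply_of_lt u c (show (⟨k + 2, hk⟩ : Fin (n + 2 + 1)).1 < n + 2 from hk2),
        wordSnoc_apply_of_lt u c (show (⟨k, by omega⟩ : Fin (n + 2 + 1)).1 < n + 2 by simp; omega)]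
      exact hu.2 k hk2
    · have hk' : k = n := by omega
      subst hk'
      rw [wordSnoc_apply_of_lt u c (show (⟨k, by omega⟩ : Fin (k + 2 + 1)).1 < k + 2 by simp)]
      rwa [wordSnoc_last]

/-- **`S_n + T_n ≤ S_{n+1}`** (the straight continuation): equality in fact, with `card_nawFourS_succ_le`. [folklore] -/
theorem card_nawFourWords_le_card_nawFourS_succ (d n : ℕ) :
    (nawFourWords d (n + 2)).card ≤ (nawFourS d (n + 1)).card := by
  classical
  refine Finset.card_le_card_of_injOn (fun u => wordSnoc u (u ⟨n + 1, by omega⟩)) (fun u hu => ?_)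
    (fun u _ u' _ h => (MemoryTail.wordSnoc_inj' h).1)
  rw [Finset.mem_coe, mem_nawFourWords] at hu
  rw [Finset.mem_coe, nawFourS, Finset.mem_filter, mem_nawFourWords]
  refine ⟨isNAWFour_wordSnoc hu ?_ ?_, ?_⟩
  · intro h; exact absurd h (by obtain ⟨j, s⟩ := u ⟨n + 1, by omega⟩; cases s <;> simp [srev])
  · exact hu.1 n (by omega)
  · beta_reduce
    rw [wordSnoc_apply_of_lt u _ (show (⟨n + 1, by omega⟩ : Fin (n + 2 + 1)).1 < n + 2 by simp)]
    exact wordSnoc_last u _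

/-- `#nextT a b ≥ 2d − 3`, and `= 2d − 2`... at least `2d − 2` when `a = b`. [folklore] -/
theorem le_card_nextT (a b : Fin d × Bool) : (if a = b then 2 * d - 2 else 2 * d - 3) ≤ (nextT a b).card := by
  classical
  have hsub : (Finset.univ : Finset (Fin d × Bool)) \ {b, srev b, srev a} ⊆ nextT a b := by
    intro c hc
    simp only [Finset.mem_sdiff, Finset.mem_univ, Finset.mem_insert, Finset.mem_singleton, true_and, not_or] at hc
    simp only [nextT, Finset.mem_filter, Finset.mem_univ, true_and]
    exact ⟨hc.1, hc.2.1, hc.2.2⟩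
  have hcard := Finset.card_le_card hsub
  rw [Finset.card_sdiff_of_subset (Finset.subset_univ _), Finset.card_univ, Fintype.card_prod, Fintype.card_fin,
    Fintype.card_bool] at hcard
  have h3 : ({b, srev b, srev a} : Finset (Fin d × Bool)).card ≤ 3 := Finset.card_le_three
  split_ifs with hab
  · subst hab
    have h2 : ({a, srev a, srev a} : Finset (Fin d × Bool)).card ≤ 2 := by
      rw [show ({a, srev a, srev a} : Finset (Fin d × Bool)) = {a, srev a} by simp]
      exact Finset.card_le_two
    omega
  · omega

/-- **`(2d−2) S_n + (2d−3) T_n ≤ T_{n+1}`** (the turning continuations): equality in fact, with `card_nawFourT_succ_le`. [folklore] -/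
theorem le_card_nawFourT_succ (d n : ℕ) :
    (2 * d - 2) * (nawFourS d n).card + (2 * d - 3) * (nawFourT d n).card ≤ (nawFourT d (n + 1)).card := by
  classical
  -- domain: pairs (u, c) with c an admissible turning step
  set D := (nawFourWords d (n + 2)).sigma fun u => nextT (u ⟨n, by omega⟩) (u ⟨n + 1, by omega⟩) with hD
  have hmap : D.card ≤ (nawFourT d (n + 1)).card := by
    refine Finset.card_le_card_of_injOn (fun p => wordSnoc p.1 p.2) (fun p hp => ?_) (fun p hp p' hp' h => ?_)
    · rw [Finset.mem_coe, hD, Finset.mem_sigma, mem_nawFourWords] at hp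
      obtain ⟨hu, hc⟩ := hp
      simp only [nextT, Finset.mem_filter, Finset.mem_univ, true_and] at hc
      rw [Finset.mem_coe, nawFourT, Finset.mem_filter, mem_nawFourWords]
      refine ⟨isNAWFour_wordSnoc hu hc.2.1 hc.2.2, ?_⟩
      beta_reduce
      rw [wordSnoc_apply_of_lt p.1 _ (show (⟨n + 1, by omega⟩ : Fin (n + 2 + 1)).1 < n + 2 by simp)]
      rw [show (⟨n + 1 + 1, _⟩ : Fin (n + 2 + 1)) = ⟨n + 2, by omega⟩ from rfl, wordSnoc_last]
      exact hc.1
    · obtain ⟨h1, h2⟩ := MemoryTail.wordSnoc_inj' h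
      exact Sigma.ext h1 (heq_of_eq h2)
  refine le_trans ?_ hmap
  rw [hD, Finset.card_sigma, ← Finset.sum_filter_add_sum_filter_not (nawFourWords d (n + 2))
    (fun u => u ⟨n + 1, by omega⟩ = u ⟨n, by omega⟩)]
  have hS : (2 * d - 2) * (nawFourS d n).card ≤
      ∑ u ∈ (nawFourWords d (n + 2)).filter (fun u => u ⟨n + 1, by omega⟩ = u ⟨n, by omega⟩),
        (nextT (u ⟨n, by omega⟩) (u ⟨n + 1, by omega⟩)).card := by
    rw [nawFourS, mul_comm, ← smul_eq_mul, ← Finset.sum_const]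
    refine Finset.sum_le_sum fun u hu => ?_
    rw [Finset.mem_filter] at hu
    have := le_card_nextT (u ⟨n, by omega⟩) (u ⟨n + 1, by omega⟩)
    rw [if_pos hu.2.symm] at this
    exact this
  have hT : (2 * d - 3) * (nawFourT d n).card ≤
      ∑ u ∈ (nawFourWords d (n + 2)).filter (fun u => ¬ u ⟨n + 1, by omega⟩ = u ⟨n, by omega⟩),
        (nextT (u ⟨n, by omega⟩) (u ⟨n + 1, by omega⟩)).card := by
    rw [nawFourT, mul_comm, ← smul_eq_mul, ← Finset.sum_const]
    refine Finset.sum_le_sum fun u hu => ?_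
    have := le_card_nextT (u ⟨n, by omega⟩) (u ⟨n + 1, by omega⟩)
    split_ifs at this <;> omega
  exact add_le_add hS hT





/-- Both end classes are non-empty in length `2` (`d ≥ 2`): `(e₀, e₀) ∈ S_0`, `(e₀, e₁) ∈ T_0`. [folklore] -/
theorem one_le_card_nawFourS_zero_and_T_zero (hd : 2 ≤ d) : 1 ≤ (nawFourS d 0).card ∧ 1 ≤ (nawFourT d 0).card := by
  classical
  obtain ⟨d', rfl⟩ : ∃ d', d = d' + 2 := ⟨d - 2, by omega⟩
  let e0 : Fin (d' + 2) := ⟨0, by omega⟩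
  let e1 : Fin (d' + 2) := ⟨1, by omega⟩
  have hne : e0 ≠ e1 := by simp [e0, e1]
  refine ⟨Finset.one_le_card.2 ⟨fun _ => (e0, true), ?_⟩, Finset.one_le_card.2 ⟨fun i => if i.val = 0 then (e0, true) else (e1, true), ?_⟩⟩
  · simp only [nawFourS, Finset.mem_filter, mem_nawFourWords, IsNAWFour, and_true]
    refine ⟨fun k hk h => ?_, fun k hk => by omega⟩
    simp [srev] at h
  · simp only [nawFourT, Finset.mem_filter, mem_nawFourWords, IsNAWFour]
    refine ⟨⟨fun k hk h => ?_, fun k hk => by omega⟩, ?_⟩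
    · have hk0 : k = 0 := by omega
      subst hk0
      simp [srev] at h
    · simp [hne.symm]

/-- **The lower geometric bounds `S_n ≥ c λ_d^n`, `T_n ≥ c λ_d^n (λ_d − 1)`** (`c = min 1 (1/(λ_d−1)) > 0`), by the exact recursion
and `λ_d² = (2d−2)λ_d + 1`. [folklore] -/
theorem nawFourST_ge (hd : 2 ≤ d) :
    let lam : ℝ := (d - 1 : ℝ) + Real.sqrt ((d - 1) ^ 2 + 1)
    let c : ℝ := min 1 (1 / (lam - 1))
    ∀ n : ℕ, c * lam ^ n ≤ (nawFourS d n).card ∧ c * lam ^ n * (lam - 1) ≤ (nawFourT d n).card := by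
  intro lam c
  have hd' : (2 : ℝ) ≤ d := by exact_mod_cast hd
  have hr2 : Real.sqrt (((d : ℝ) - 1) ^ 2 + 1) ^ 2 = ((d : ℝ) - 1) ^ 2 + 1 := Real.sq_sqrt (by positivity)
  have hr1 : 1 < Real.sqrt (((d : ℝ) - 1) ^ 2 + 1) := by
    rw [show (1 : ℝ) = Real.sqrt 1 by simp]
    exact Real.sqrt_lt_sqrt (by norm_num) (by nlinarith)
  have hlam1 : 1 < lam := by simp only [lam]; linarith
  have hlam0 : 0 < lam := by linarith
  have hquad : lam ^ 2 = (2 * d - 2) * lam + 1 := by simp only [lam]; nlinarith [hr2]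
  have hc0 : 0 < c := lt_min one_pos (div_pos one_pos (by linarith))
  have hc1 : c ≤ 1 := min_le_left _ _
  have hc2 : c * (lam - 1) ≤ 1 := by
    have := min_le_right 1 (1 / (lam - 1))
    calc c * (lam - 1) ≤ 1 / (lam - 1) * (lam - 1) := by gcongr
      _ = 1 := one_div_mul_cancel (by linarith)
  intro n
  induction n with
  | zero =>
    obtain ⟨hS, hT⟩ := one_le_card_nawFourS_zero_and_T_zero hd
    have hS' : (1 : ℝ) ≤ (nawFourS d 0).card := by exact_mod_cast hS
    have hT' : (1 : ℝ) ≤ (nawFourT d 0).card := by exact_mod_cast hT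
    constructor <;> simp only [pow_zero, mul_one] <;> linarith
  | succ n ih =>
    obtain ⟨iS, iT⟩ := ih
    have hSrec : ((nawFourS d n).card : ℝ) + (nawFourT d n).card ≤ (nawFourS d (n + 1)).card := by
      have := card_nawFourWords_le_card_nawFourS_succ d n
      rw [card_nawFourWords_eq] at this
      exact_mod_cast this
    have hTrec : (2 * (d : ℝ) - 2) * (nawFourS d n).card + (2 * (d : ℝ) - 3) * (nawFourT d n).card ≤
        (nawFourT d (n + 1)).card := by
      have := le_card_nawFourT_succ d n
      have h' : (((2 * d - 2) * (nawFourS d n).card + (2 * d - 3) * (nawFourT d n).card : ℕ) : ℝ) ≤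
          (nawFourT d (n + 1)).card := by exact_mod_cast this
      rw [Nat.cast_add, Nat.cast_mul, Nat.cast_mul, Nat.cast_sub (by omega), Nat.cast_sub (by omega)] at h'
      push_cast at h'
      exact h'
    have hpow : 0 ≤ c * lam ^ n := by positivity
    constructor
    · calc c * lam ^ (n + 1) = c * lam ^ n + c * lam ^ n * (lam - 1) := by ring
        _ ≤ _ := by linarith
    · have h23 : (0 : ℝ) ≤ 2 * d - 3 := by linarith
      have h22 : (0 : ℝ) ≤ 2 * d - 2 := by linarith
      calc c * lam ^ (n + 1) * (lam - 1) = c * lam ^ n * (lam ^ 2 - lam) := by ring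
        _ = c * lam ^ n * ((2 * d - 2) + (2 * d - 3) * (lam - 1)) := by rw [hquad]; ring
        _ = (2 * d - 2) * (c * lam ^ n) + (2 * d - 3) * (c * lam ^ n * (lam - 1)) := by ring
        _ ≤ (2 * (d : ℝ) - 2) * (nawFourS d n).card + (2 * (d : ℝ) - 3) * (nawFourT d n).card := by
            gcongr
        _ ≤ _ := hTrec

/-- **`N_{n+2,3} ≥ c λ_d^{n+1}`**: memory-3 (= memory-4) neighbour-avoiding words grow at least like `λ_d^n`. [folklore] -/
theorem nawMemCount_three_ge (hd : 2 ≤ d) (n : ℕ) :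
    min 1 (1 / (((d - 1 : ℝ) + Real.sqrt ((d - 1) ^ 2 + 1)) - 1)) * ((d - 1 : ℝ) + Real.sqrt ((d - 1) ^ 2 + 1)) ^ (n + 1)
      ≤ nawMemCount d 3 (n + 2) := by
  obtain ⟨hS, hT⟩ := nawFourST_ge hd n
  unfold nawMemCount
  rw [nawMemWords_three_eq_nawFourWords, card_nawFourWords_eq]
  push_cast
  calc _ = min 1 (1 / (((d - 1 : ℝ) + Real.sqrt ((d - 1) ^ 2 + 1)) - 1)) * ((d - 1 : ℝ) + Real.sqrt ((d - 1) ^ 2 + 1)) ^ n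
        + min 1 (1 / (((d - 1 : ℝ) + Real.sqrt ((d - 1) ^ 2 + 1)) - 1)) * ((d - 1 : ℝ) + Real.sqrt ((d - 1) ^ 2 + 1)) ^ n
          * (((d - 1 : ℝ) + Real.sqrt ((d - 1) ^ 2 + 1)) - 1) := by ring
    _ ≤ _ := add_le_add hS hT

/-- **`μ^N_3(d) ≥ λ_d`** (`μ^N_3 = lim N_{n,3}^{1/n}` and `N_{n+2,3} ≥ c λ_d^{n+1}`). [folklore] -/
theorem nawFourConst_le_nawMemGrowth_three (hd : 2 ≤ d) :
    (d - 1 : ℝ) + Real.sqrt ((d - 1) ^ 2 + 1) ≤ nawMemGrowth d 3 := by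
  haveI : NeZero d := ⟨by omega⟩
  set lam : ℝ := (d - 1 : ℝ) + Real.sqrt ((d - 1) ^ 2 + 1) with hlam
  set c : ℝ := min 1 (1 / (lam - 1)) with hc
  have hd' : (2 : ℝ) ≤ d := by exact_mod_cast hd
  have hr1 : 1 < Real.sqrt (((d : ℝ) - 1) ^ 2 + 1) := by
    rw [show (1 : ℝ) = Real.sqrt 1 by simp]
    exact Real.sqrt_lt_sqrt (by norm_num) (by nlinarith)
  have hlam1 : 1 < lam := by rw [hlam]; linarith
  have hlam0 : 0 < lam := by linarith
  have hc0 : 0 < c := lt_min one_pos (div_pos one_pos (by linarith))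
  -- a_n = (c λ^{n+1})^{1/(n+2)} = (c/λ)^{1/(n+2)} λ → λ
  have ha : Tendsto (fun n : ℕ => (c * lam ^ (n + 1)) ^ (1 / ((n : ℝ) + 2))) atTop (𝓝 lam) := by
    have h0 : ContinuousAt (fun x : ℝ => (c / lam) ^ x) 0 := Real.continuousAt_const_rpow (div_pos hc0 hlam0).ne'
    have h1 : Tendsto (fun n : ℕ => 1 / ((n : ℝ) + 2)) atTop (𝓝 0) := by
      have h2 := (tendsto_one_div_add_atTop_nhds_zero_nat (𝕜 := ℝ)).comp (tendsto_add_atTop_nat 1)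
      refine h2.congr fun n => ?_
      simp only [Function.comp_apply]; push_cast; ring
    have h3 : Tendsto (fun n : ℕ => (c / lam) ^ (1 / ((n : ℝ) + 2)) * lam) atTop (𝓝 lam) := by
      have := (h0.tendsto.comp h1).mul_const lam
      simpa [Real.rpow_zero, Function.comp_def] using this
    refine h3.congr fun n => ?_
    have hn2 : (0 : ℝ) < (n : ℝ) + 2 := by positivity
    have hKl : c * lam ^ (n + 1) = (c / lam) * lam ^ (n + 2) := by field_simp; ring
    rw [hKl, Real.mul_rpow (div_pos hc0 hlam0).le (by positivity)]
    congr 1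
    rw [← Real.rpow_natCast lam (n + 2), ← Real.rpow_mul hlam0.le]
    push_cast
    rw [mul_one_div_cancel hn2.ne', Real.rpow_one]
  -- b_n = N_{n+2,3}^{1/(n+2)} → μ^N_3
  have hb : Tendsto (fun n : ℕ => (nawMemCount d 3 (n + 2) : ℝ) ^ (1 / ((n : ℝ) + 2))) atTop (𝓝 (nawMemGrowth d 3)) := by
    have := (tendsto_nawMemCount_rpow (d := d) 3).comp (tendsto_add_atTop_nat 2)
    refine this.congr fun n => ?_
    simp only [Function.comp_apply]; push_cast; rfl
  refine le_of_tendsto_of_tendsto' ha hb fun n => ?_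
  exact Real.rpow_le_rpow (by positivity) (by simpa [hlam, hc] using nawMemCount_three_ge hd n) (by positivity)


/-! ### The identification `μ^N_4 = λ_d` and the first complete window instance -/

/-- **`μ^N_3(d) = λ_d = (d−1) + √((d−1)²+1)`** (`d ≥ 2`). [folklore] -/
theorem nawMemGrowth_three_eq (hd : 2 ≤ d) : nawMemGrowth d 3 = (d - 1 : ℝ) + Real.sqrt ((d - 1) ^ 2 + 1) := by
  refine le_antisymm ?_ (nawFourConst_le_nawMemGrowth_three hd)
  have h := nawMemGrowth_four_le_nawFourConst hd
  rwa [show (4 : ℕ) = 2 * 2 from rfl, nawMemGrowth_even_eq (k := 2) le_rfl d] at h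

/-- **`μ^N_4(d) = λ_d = (d−1) + √((d−1)²+1)` EXACTLY** (`d ≥ 2`): the `τ = 4` entry of the site memory column (the engines'
`4.2360680 = 2 + √5` for `d = 3`) is identified. [folklore] -/
theorem nawMemGrowth_four_eq (hd : 2 ≤ d) : nawMemGrowth d 4 = (d - 1 : ℝ) + Real.sqrt ((d - 1) ^ 2 + 1) := by
  rw [show (4 : ℕ) = 2 * 2 from rfl, nawMemGrowth_even_eq (k := 2) le_rfl d]
  exact nawMemGrowth_three_eq hd

/-- **`Δ^N_4(d) = ln((2d−1)/λ_d)`** in closed form (`d ≥ 2`). [folklore] -/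
theorem siteLoopCost_four_eq (hd : 2 ≤ d) :
    siteLoopCost d 4 = Real.log ((2 * (d : ℝ) - 1) / ((d - 1 : ℝ) + Real.sqrt ((d - 1) ^ 2 + 1))) := by
  haveI : NeZero d := ⟨by omega⟩
  unfold siteLoopCost
  rw [show (4 : ℕ) - 2 = 2 from rfl, nawMemGrowth_two_eq, nawMemGrowth_four_eq hd]

/-- `λ_d ≥ (4d²−6d+3)/(2d−1) = 2d − 2 + 1/(2d−1)` (`√((d−1)²+1) ≥ (d−1) + 1/(2d−1)`). [folklore] -/
theorem nawFourConst_ge (hd : 2 ≤ d) :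
    (4 * (d : ℝ) ^ 2 - 6 * d + 3) / (2 * d - 1) ≤ (d - 1 : ℝ) + Real.sqrt ((d - 1) ^ 2 + 1) := by
  have hd' : (2 : ℝ) ≤ d := by exact_mod_cast hd
  have h2d1 : (0 : ℝ) < 2 * d - 1 := by linarith
  set t : ℝ := 1 / (2 * d - 1) with ht
  have ht0 : 0 < t := by rw [ht]; exact div_pos one_pos h2d1
  have ht1 : t * (2 * d - 1) = 1 := by rw [ht]; exact one_div_mul_cancel h2d1.ne'
  have htle : t ≤ 1 := by nlinarith
  have hkey : ((d : ℝ) - 1 + t) ≤ Real.sqrt (((d : ℝ) - 1) ^ 2 + 1) := by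
    rw [Real.le_sqrt (by linarith) (by positivity)]
    nlinarith
  have hq : (4 * (d : ℝ) ^ 2 - 6 * d + 3) / (2 * d - 1) = (d : ℝ) - 1 + ((d : ℝ) - 1 + t) := by
    rw [div_eq_iff h2d1.ne']
    nlinarith [ht1]
  rw [hq]
  linarith

/-- **`R^N_4(d) < 1` for EVERY `d ≥ 2`**: with `siteLoopCompat_four_pos` the first rung of the typed site window
`siteLoopCompatWindow` is COMPLETELY proved, `0 < R^N_4(d) < 1` (measured 0.720 / 0.797 / 0.841 / 0.869 for d = 3..6).
Proof: `Δ = ln((2d−1)/λ_d) ≤ (2d−1)/λ_d − 1 ≤ (2d−1)²/(4d²−6d+3) − 1 = (2d−2)/(4d²−6d+3)`, `f ≥ 2d(2d−2)·2d/(2d−1)⁴`, and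
`(2d−2)(2d−1)⁴ < 8d²(d−1)(4d²−6d+3)` ⟺ `0 < 8d³ − 12d² + 8d − 1`. [folklore] -/
theorem siteLoopCompat_four_lt_one (hd : 2 ≤ d) : siteLoopCompat d 4 < 1 := by
  haveI : NeZero d := ⟨by omega⟩
  have hd' : (2 : ℝ) ≤ d := by exact_mod_cast hd
  have h2d1 : (0 : ℝ) < 2 * d - 1 := by linarith
  set Q : ℝ := 4 * (d : ℝ) ^ 2 - 6 * d + 3 with hQ
  have hQ0 : 0 < Q := by rw [hQ]; nlinarith
  have hQne : Q ≠ 0 := hQ0.ne'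
  set lam : ℝ := (d - 1 : ℝ) + Real.sqrt ((d - 1) ^ 2 + 1) with hlam
  have hLlam : Q / (2 * d - 1) ≤ lam := nawFourConst_ge hd
  have hL0 : 0 < Q / (2 * d - 1) := div_pos hQ0 h2d1
  have hlam0 : 0 < lam := lt_of_lt_of_le hL0 hLlam
  -- the cost
  have hΔ : siteLoopCost d 4 ≤ (2 * d - 2) / Q := by
    rw [siteLoopCost_four_eq hd]
    have hx : 0 < (2 * (d : ℝ) - 1) / lam := div_pos h2d1 hlam0
    refine (Real.log_le_sub_one_of_pos hx).trans ?_
    have h1 : (2 * (d : ℝ) - 1) / lam ≤ (2 * (d : ℝ) - 1) / (Q / (2 * d - 1)) := by gcongr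
    have h2 : (2 * (d : ℝ) - 1) / (Q / (2 * d - 1)) - 1 = (2 * d - 2) / Q := by
      rw [div_div_eq_mul_div, div_sub_one hQne, hQ]
      ring
    linarith
  -- the density
  have hf : 8 * (d : ℝ) ^ 2 * (d - 1) / (2 * d - 1) ^ 4 ≤ siteLoopDensity d 4 := by
    unfold siteLoopDensity
    rw [show (4 : ℕ) - 2 = 2 from rfl, nawMemGrowth_two_eq]
    have hc : (2 * (d : ℝ)) * (2 * d - 2) ≤ (closingNawCount d 4 : ℝ) := by
      have := closingNawCount_four_ge hd
      have h' : ((2 * d * (2 * d - 2) : ℕ) : ℝ) ≤ (closingNawCount d 4 : ℝ) := by exact_mod_cast this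
      rw [Nat.cast_mul, Nat.cast_mul, Nat.cast_sub (by omega)] at h'
      push_cast at h'
      linarith
    rw [show 8 * (d : ℝ) ^ 2 * (d - 1) / (2 * d - 1) ^ 4 = (2 * (d : ℝ)) * (2 * d - 2) * (1 + (2 * d - 1)) / (2 * d - 1) ^ 4
      by ring]
    have h4 : (0 : ℝ) < (2 * d - 1) ^ 4 := by positivity
    have h5 : (0 : ℝ) ≤ 1 + (2 * (d : ℝ) - 1) := by linarith
    exact div_le_div_of_nonneg_right (mul_le_mul_of_nonneg_right hc h5) h4.le
  -- the polynomial inequality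
  have hpoly : (2 * d - 2) / Q < 8 * (d : ℝ) ^ 2 * (d - 1) / (2 * d - 1) ^ 4 := by
    rw [div_lt_div_iff₀ hQ0 (by positivity), hQ]
    have hcubic : (0 : ℝ) < 8 * (d : ℝ) ^ 3 - 12 * d ^ 2 + 8 * d - 1 := by nlinarith
    nlinarith [mul_pos hcubic (by linarith : (0 : ℝ) < d - 1)]
  have hnum : (0 : ℝ) < 8 * (d : ℝ) ^ 2 * (d - 1) / (2 * d - 1) ^ 4 :=
    div_pos (mul_pos (by positivity) (by linarith)) (pow_pos h2d1 4)
  have hfpos : (0 : ℝ) < siteLoopDensity d 4 := lt_of_lt_of_le hnum hf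
  unfold siteLoopCompat
  rw [div_lt_one hfpos]
  linarith

/-- `R^N_4(ℤ³) < 1` (the lane's headline dimension; measured 0.7196). [folklore] -/
theorem siteLoopCompat_four_three_lt_one : siteLoopCompat 3 4 < 1 := siteLoopCompat_four_lt_one (by norm_num)

/-- **The `m = 2` instance of the typed conjecture `siteLoopCompatWindow` is a theorem**: `0 < R^N_4(d) < 1` for every
`d ≥ 2` (so in particular for the clause's `d ≥ 3`). [folklore] -/
theorem siteLoopCompatWindow_rung_four (d : ℕ) (hd : 2 ≤ d) :
    0 < siteLoopCompat d (2 * 2) ∧ siteLoopCompat d (2 * 2) < 1 :=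
  ⟨siteLoopCompat_four_pos hd, siteLoopCompat_four_lt_one hd⟩

end Summit.CriticalPhenomena.PercolationContinuityZ3.Theorems.Pcint.NawTail
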